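import Summits.QuantumFields.YangMills.Theorems.IR.AfPincerUcTypClusterPeierls
import Summits.QuantumFields.YangMills.Theorems.IR.Negative.ClauseITypChainDeepFalseOfFilmWire
import HarnessLib

/-!
# Crux `IR` (stmt-QuantumFields-19354), line `af-pincer-Uc`: the CLUSTER-COUNT class `TypCluster` (3/3) — clause (ii) REDUCED BY NAME,
# the lane-A supplier targets of the count class composed to I♯_SC and `IR`, and the FREE RE-CUT
# `TypChainReducedAtSC → TypClusterReducedAtSC` (seat ym-19354-afpincer-s1 g5)

Helper module for item `stmt-QuantumFields-19354` (`--supports stmt-QuantumFields-19354 --as helper`; it closes nothing; registry and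
slot of record «sharp merge I♯_SC» `Cruxes/IR/Lines/af_pincer_Uc_sharp.lean` sha16 `28967a1bf60ad397` UNTOUCHED; open stub
`stub_onsetSharpSC : AfPincerUc.SharpOnset.OnsetSharpUKPcSC`).  Parts 1–2 (`AfPincerUcTypCluster`, `AfPincerUcTypClusterPeierls`): the count class
`TypCluster ρ θ w k`, `⊆ TypChain θ ℓ₀` for `2k ≤ ℓ₀ + 1`, R109 (3), the cluster Peierls engine and clause (iii) PROVED.  THIS FILE:

* §3 `KernelPlaqSparseCluster ρ β w θ k q` — the (ii)-side content NAMED with the count class's OWN guard (NOT proved anywhere; `.mono`); it is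
  IMPLIED by the class of record's `KernelPlaqSparse ρ β w θ ℓ₀ q` (p544202) whenever `2k ≤ ℓ₀ + 1` (**`kernelPlaqSparseCluster_of_kernelPlaqSparse`**,
  guard monotonicity: a count-typical neighbour is chain-typical); `clauseIIukp_typCluster_of_kernelSparse` ∕ `_of_kernelPlaqSparse` ((ii) ⟸
  sparseness + budget `(2k+1) · 96 b⁴ · 3750^{2k} · q^{k+1} ≤ δ`, cluster Peierls with `Φ = id`).
* §4 `clusterSizeOf θ κ C := max (halfExtent (θ/12) C) (halfExtent κ C)` (`extentOf = 2 · clusterSizeOf`, `extentOf_eq_two_mul_clusterSizeOf`);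
  suppliers **`TypClusterSharpSC`** (format instantiation at `TypCluster r.ρ θ w k`, any count `k`) and **`TypClusterReducedAtSC`** (clause (i) for
  `TypCluster θ (clusterSizeOf θ κ C)` + `KernelPlaqSparseCluster` at base `e^{−κβ}`, meshes `b ≤ B e^{Cβ}`; no (iii), no (ii) bookkeeping);
  `clauses_typCluster_sizeOf` (per-`(G, r)` engine), `typClusterSharpSC_of_reducedAt`, `onsetSharpUKPcSC_of_typCluster{Sharp,ReducedAt}SC` (⇒ I♯_SC),
  `ir_of_typCluster{Sharp,ReducedAt}SC` (∧ `IRNSC` ⇒ `BalabanLadder.IR` BY NAME).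
* **`typClusterReducedAtSC_of_typChainReducedAtSC` — THE RE-CUT IS FREE (PROVED)**: the class of record's reduced lane-A target `TypChainReducedAtSC`
  (p544202) IMPLIES the count class's, with the same printed data (clause (i) is antitone in the class and `TypCluster θ (extentOf/2) ⊆ TypChain θ extentOf`;
  `KernelPlaqSparse` is guard-monotone), and `ir_of_typChainReducedAtSC_via_cluster`.  READING for the owner: instantiating the format's `∃ Typ` at
  `TypCluster θ (extentOf θ κ C / 2)` instead of `TypChain θ (extentOf θ κ C)` asks NOTHING more of a lane-A supplier and EXCLUDES, by format, every
  wall line, film or rough patch threading `extentOf/2 + 1` `θ`-bad own plaquettes at ANY scale or depth (part 1 `not_mem_typCluster_of_injective`) —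
  the data that `TypChain` admits below extent `extentOf` (disprove-1 GEN 13 `boxConfig_mem_typChain`, `PatchFilmWireAt`) and `TypChainDeep` admits in
  every boundary layer (GEN 12 `DeepFilmWireAt`).  Residual (i)-exposure of the count class: connected rough families of `≤ extentOf/2` bad plaquettes
  (at the Peierls floor, `≤ 4C⁺/κ`); whether such small patches carry film order is the disprover's open census (dust does not: j289201/j289202/j289334).

* §5 calibration BY NAME against the disprover's data: `mem_typCluster_of_sparseLabels` (what the class ADMITS, exactly: bad own plaquettes whose
  `2`-step-connected components have `≤ k` members) and **`lineConfig_not_mem_typCluster`** (GEN 12's wall line, typical for every deep class, is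
  excluded by count for every `k ≤ b − 2` and every `θ ≤ N − Re tr ρ g`).

NOT done here: clause (i) for collars typical in the count sense and the kernel sparseness itself (the open content of `stub_onsetSharpSC`, unchanged
in kind).  HONEST FRAMING: by-name bookkeeping around ONE open stub of a CONDITIONAL chain (Track A 0/28 UV); nothing of weak-coupling mixing,
asymptotic freedom or a gap is proved or claimed; not infinite volume, not Clay.  No `sorry`; axioms ⊆ {propext, Classical.choice, Quot.sound};
no instances, no notation.
-/

set_option autoImplicit false

noncomputable section

open Filter Topology MeasureTheory
open Literature.MathematicalPhysics.QuantumFieldTheory hiding ZdEdge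
open Literature.MathematicalPhysics.QuantumLattice
open Literature.Probability.LatticeModels (Site)
open Summit.QuantumFields.YangMills.Cruxes.OSLegsFromFemtoAndGap.DlrCollarTransfer (LowerBounds)
open Summit.QuantumFields.YangMills.Cruxes.IR.Tempered (regionEdges)
open Summit.QuantumFields.YangMills.Theorems.OddTorusChessboard (cellPlaqs plaqAction cellSites
  fst_mem_cellSites_of_mem_cellPlaqs cellSites_subset_box card_cellPlaqs_le card_orient_four)

namespace Summit.QuantumFields.YangMills.Cruxes.IR.AfPincerUc.SharpLanes

open Summit.QuantumFields.YangMills.Cruxes.IR.AfPincerUc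

/-! ## §3 Clause (ii) (UKP) for the count class, REDUCED BY NAME to kernel sparseness with the count class's own guard -/
section Kernel

variable {G : Type} [Group G] [TopologicalSpace G] [IsTopologicalGroup G] [CompactSpace G]
  [MeasurableSpace G] [BorelSpace G]

/-- **Kernel plaquette-set sparseness with the COUNT-CLASS guard (the (ii)-side content, NAMED; NOT proved anywhere).**  As `KernelPlaqSparse`
(p544202) with the guard «each cell within sup-distance `1` of a charged cell is resampled or `TypCluster ρ θ w k`-typical»: FEWER exteriors than
the class of record's guard admits whenever `2k ≤ ℓ₀ + 1` (`kernelPlaqSparseCluster_of_kernelPlaqSparse`). -/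
def KernelPlaqSparseCluster {N : ℕ} (ρ : G →* Matrix (Fin N) (Fin N) ℂ) (β : ℝ) (w : Fin 4 → ℤ → ℤ) (θ : ℝ) (k : ℕ)
    (q : ℝ) : Prop :=
  ∀ F F' : Finset (Fin 4 → ℤ), F ⊆ F' → F.Nonempty → ∀ ζ : LGConfig 4 G,
    (∀ c ∈ F, ∀ c' : Fin 4 → ℤ, (∀ i, |c' i - c i| ≤ 1) → c' ∈ F' ∨ ζ ∈ TypCluster ρ θ w k c') →
      ∀ X : Finset (ZdPlaquette 4), X ⊆ F.biUnion (cellPlaqs w) →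
        (ymSpecification ρ β (regionEdges w F') ζ) {σ : LGConfig 4 G | ∀ p ∈ X, θ ≤ plaqAction ρ p σ} ≤
          ENNReal.ofReal (q ^ X.card)

/-- `KernelPlaqSparseCluster` is antitone in the base. -/
theorem KernelPlaqSparseCluster.mono {N : ℕ} {ρ : G →* Matrix (Fin N) (Fin N) ℂ} {β : ℝ} {w : Fin 4 → ℤ → ℤ} {θ : ℝ}
    {k : ℕ} {q q' : ℝ} (hq0 : 0 ≤ q) (hqq' : q ≤ q') (h : KernelPlaqSparseCluster ρ β w θ k q) :
    KernelPlaqSparseCluster ρ β w θ k q' :=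
  fun F F' hFF' hF ζ hguard X hX =>
    (h F F' hFF' hF ζ hguard X hX).trans (ENNReal.ofReal_le_ofReal (pow_le_pow_left₀ hq0 hqq' _))

/-- **The class of record's kernel sparseness IMPLIES the count class's (PROVED; guard monotonicity):** for `2k ≤ ℓ₀ + 1` a `TypCluster θ k`-typical
neighbour is `TypChain θ ℓ₀`-typical (`typCluster_subset_typChain`). -/
theorem kernelPlaqSparseCluster_of_kernelPlaqSparse {N : ℕ} {ρ : G →* Matrix (Fin N) (Fin N) ℂ} {β : ℝ} {w : Fin 4 → ℤ → ℤ}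
    {θ : ℝ} {k ℓ₀ : ℕ} (hkℓ : 2 * k ≤ ℓ₀ + 1) {q : ℝ} (h : KernelPlaqSparse ρ β w θ ℓ₀ q) :
    KernelPlaqSparseCluster ρ β w θ k q :=
  fun F F' hFF' hF ζ hguard X hX =>
    h F F' hFF' hF ζ (fun c hc c' hc' => (hguard c hc c' hc').imp_right fun hζ => typCluster_subset_typChain w hkℓ c' hζ) X hX

/-- **Clause (ii) in UKP form for `TypCluster`, from kernel sparseness with the count class's own guard (reduction; `hsp` NOT proved here).**
With `0 ≤ q ≤ 1` and the budget `(2k+1) · 96 b⁴ · 3750^{2k} · q^{k+1} ≤ δ`, `ClauseIIukp ρ β w δ (TypCluster ρ θ w k)` holds (cluster Peierls, `Φ = id`). -/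
theorem clauseIIukp_typCluster_of_kernelSparse {N : ℕ} (ρ : G →* Matrix (Fin N) (Fin N) ℂ) (β : ℝ) {b : ℕ}
    {w : Fin 4 → ℤ → ℤ} (hw : IsFrame b w) (θ : ℝ) (k : ℕ) {q δ : ℝ} (hq0 : 0 ≤ q) (hq1 : q ≤ 1)
    (hδ : ((2 * k + 1 : ℕ) : ℝ) * (96 * (b : ℝ) ^ 4) * 3750 ^ (2 * k) * q ^ (k + 1) ≤ δ)
    (hsp : KernelPlaqSparseCluster ρ β w θ k q) :
    ClauseIIukp ρ β w δ (TypCluster ρ θ w k) := by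
  classical
  intro F F' hFF' hF ζ hguard
  have hn : ∀ c ∈ F, (cellPlaqs w c).card ≤ 96 * b ^ 4 := fun c _ => by
    have h := card_cellPlaqs_le hw c
    rw [card_orient_four] at h
    calc (cellPlaqs w c).card ≤ (2 * b) ^ 4 * 6 := h
      _ = 96 * b ^ 4 := by ring
  have hmain := measure_forall_hasBadClusterAmong_le_pow ρ (ymSpecification ρ β (regionEdges w F') ζ) id θ F
    (cellPlaqs w) (F.biUnion (cellPlaqs w)) (fun c hc => Finset.subset_biUnion_of_mem _ hc)
    (fun c _ c' _ hcc => disjoint_cellPlaqs hw hcc) hn hq0 hq1 (fun X hX => hsp F F' hFF' hF ζ hguard X hX) k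
  have hev : {σ : LGConfig 4 G | ∀ c ∈ F, σ ∉ TypCluster ρ θ w k c} =
      {σ | ∀ c ∈ F, HasBadClusterAmong ρ θ (↑(cellPlaqs w c)) k (id σ)} := by
    ext σ
    simp only [Set.mem_setOf_eq, TypCluster, not_not, id]
  rw [hev]
  refine hmain.trans (ENNReal.ofReal_le_ofReal (pow_le_pow_left₀ (by positivity) ?_ _))
  calc ((2 * k + 1 : ℕ) : ℝ) * ((96 * b ^ 4 : ℕ) : ℝ) * 3750 ^ (2 * k) * q ^ (k + 1)
      = ((2 * k + 1 : ℕ) : ℝ) * (96 * (b : ℝ) ^ 4) * 3750 ^ (2 * k) * q ^ (k + 1) := by push_cast; ring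
    _ ≤ δ := hδ

/-- **Clause (ii) for `TypCluster` from the class of record's NAMED `KernelPlaqSparse` (PROVED reduction), `2k ≤ ℓ₀ + 1`.** -/
theorem clauseIIukp_typCluster_of_kernelPlaqSparse {N : ℕ} (ρ : G →* Matrix (Fin N) (Fin N) ℂ) (β : ℝ) {b : ℕ}
    {w : Fin 4 → ℤ → ℤ} (hw : IsFrame b w) (θ : ℝ) {k ℓ₀ : ℕ} (hkℓ : 2 * k ≤ ℓ₀ + 1) {q δ : ℝ} (hq0 : 0 ≤ q) (hq1 : q ≤ 1)
    (hδ : ((2 * k + 1 : ℕ) : ℝ) * (96 * (b : ℝ) ^ 4) * 3750 ^ (2 * k) * q ^ (k + 1) ≤ δ) (hK : KernelPlaqSparse ρ β w θ ℓ₀ q) :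
    ClauseIIukp ρ β w δ (TypCluster ρ θ w k) :=
  clauseIIukp_typCluster_of_kernelSparse ρ β hw θ k hq0 hq1 hδ (kernelPlaqSparseCluster_of_kernelPlaqSparse hkℓ hK)

end Kernel

/-! ## §4 The lane-A supplier targets OF THE COUNT CLASS, their compositions to I♯_SC and `IR`, and the FREE re-cut -/
section Supplier

/-- **The served count**: `max ⌈48 C⁺/θ⌉₊ ⌈4 C⁺/κ⌉₊` (torus rate `θ/12`, kernel rate `κ`); `extentOf θ κ C = 2 · clusterSizeOf θ κ C`. -/
def clusterSizeOf (θ κ C : ℝ) : ℕ := max (halfExtent (θ / 12) C) (halfExtent κ C)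

/-- The served extent of the class of record is twice the served count (definitional). -/
theorem extentOf_eq_two_mul_clusterSizeOf (θ κ C : ℝ) : extentOf θ κ C = 2 * clusterSizeOf θ κ C := rfl

/-- **Lane-A supplier statement for the COUNT class (format instantiation; R107-compliant by `insertionTolerant_typCluster`).**  For every simply
connected compact simple `G`, `r`, positive unit `a → 0` with `LowerBounds G r a`: admissible `(n, ε)`, a threshold `θ`, a COUNT `k`, and for every
budget `δ > 0` a window `T` such that for all large `β` SOME mesh `b ≥ 1` with `a β · b < T` carries, on every mesh-`b` frame, clause (i) at every
centre, clause (ii) in UKP form and clause (iii) FOR `TypCluster r.ρ θ w k`. -/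
def TypClusterSharpSC : Prop :=
  ∀ (G : Type) [Group G] [TopologicalSpace G] [IsTopologicalGroup G] [CompactSpace G],
    IsCompactSimpleLieGroup G → SimplyConnectedSpace G →
    letI : MeasurableSpace G := borel G; haveI : BorelSpace G := ⟨rfl⟩;
    ∀ (r : LatticeRep G) (a : ℝ → ℝ), (∀ β, 0 < a β) → Tendsto a atTop (𝓝 0) → LowerBounds G r a →
      ∃ (n : ℕ) (ε : ℝ) (θ : ℝ) (k : ℕ), 1 ≤ n ∧ 0 ≤ ε ∧ ε * OnsetFormats.shellCount n ≤ 3 / 4 ∧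
        ∀ δ : ℝ, 0 < δ → ∃ T β₂ : ℝ, ∀ β : ℝ, β₂ ≤ β → ∃ b : ℕ, 1 ≤ b ∧ a β * (b : ℝ) < T ∧
          ∀ w : Fin 4 → ℤ → ℤ, IsFrame b w →
            ClauseIAll r.ρ β w n ε (TypCluster r.ρ θ w k) ∧ ClauseIIukp r.ρ β w δ (TypCluster r.ρ θ w k) ∧
              ClauseIII r.ρ β w b δ (TypCluster r.ρ θ w k)

/-- **`TypClusterSharpSC` ⇒ I♯_SC (PROVED)** — instantiate the format's `∃ Typ` at `TypCluster r.ρ θ w k` (`typLocal_typCluster`). -/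
theorem onsetSharpUKPcSC_of_typClusterSharpSC (h : TypClusterSharpSC) : SharpOnset.OnsetSharpUKPcSC := by
  intro G _ _ _ _ hG hsc
  letI : MeasurableSpace G := borel G
  haveI : BorelSpace G := ⟨rfl⟩
  intro r a ha hat hlb
  haveI : T2Space G := T2Space.of_injective_continuous r.injective r.continuous
  haveI : SecondCountableTopology G :=
    (r.continuous.isClosedEmbedding r.injective).isEmbedding.secondCountableTopology
  obtain ⟨n, ε, θ, k, hn, hε, hM, hrest⟩ := h G hG hsc r a ha hat hlb
  refine ⟨n, ε, hn, hε, hM, fun δ hδ => ?_⟩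
  obtain ⟨T, β₂, hβ⟩ := hrest δ hδ
  refine ⟨T, β₂, fun β hb => ?_⟩
  obtain ⟨b, hb1, hlt, hw⟩ := hβ β hb
  refine ⟨b, hb1, hlt, fun w hwf => ?_⟩
  obtain ⟨hI, hII, hIII⟩ := hw w hwf
  exact ⟨TypCluster r.ρ θ w k, typLocal_typCluster r.ρ r.continuous θ w k, hI, hII, hIII⟩

/-- **`TypClusterSharpSC` ∧ residual ⇒ `BalabanLadder.IR` BY NAME (PROVED, E discharged, no X).** -/
theorem ir_of_typClusterSharpSC (h : TypClusterSharpSC) (hN : SharpOnset.IRNSC) :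
    Summit.QuantumFields.YangMills.Theses.BalabanLadder.IR :=
  SharpOnset.ir_of_onsetSharpSC (onsetSharpUKPcSC_of_typClusterSharpSC h) hN

/-- **REDUCED lane-A supplier statement FOR THE COUNT CLASS AT THE SERVED COUNT `clusterSizeOf θ κ C`** (no clause (iii); clause (ii) in
chessboard shape with the count class's own guard).  For every simply connected compact simple `G`, `r`, positive unit `a → 0` with `LowerBounds G r a`:
admissible `(n, ε)`, a threshold `θ > 0`, a kernel rate `κ > 0` and a mesh growth `C` such that for every budget `δ > 0` there are `T, B, β₂` with: for all
`β ≥ β₂` SOME mesh `b ≥ 1`, `a β · b < T`, `b ≤ B e^{Cβ}`, carries on every mesh-`b` frame clause (i) at every centre for `TypCluster r.ρ θ w (clusterSizeOf θ κ C)`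
AND `KernelPlaqSparseCluster r.ρ β w θ (clusterSizeOf θ κ C) (e^{−κβ})`. -/
def TypClusterReducedAtSC : Prop :=
  ∀ (G : Type) [Group G] [TopologicalSpace G] [IsTopologicalGroup G] [CompactSpace G],
    IsCompactSimpleLieGroup G → SimplyConnectedSpace G →
    letI : MeasurableSpace G := borel G; haveI : BorelSpace G := ⟨rfl⟩;
    ∀ (r : LatticeRep G) (a : ℝ → ℝ), (∀ β, 0 < a β) → Tendsto a atTop (𝓝 0) → LowerBounds G r a →
      ∃ (n : ℕ) (ε θ κ C : ℝ), 1 ≤ n ∧ 0 ≤ ε ∧ ε * OnsetFormats.shellCount n ≤ 3 / 4 ∧ 0 < θ ∧ 0 < κ ∧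
        ∀ δ : ℝ, 0 < δ → ∃ T B β₂ : ℝ, ∀ β : ℝ, β₂ ≤ β →
          ∃ b : ℕ, 1 ≤ b ∧ a β * (b : ℝ) < T ∧ (b : ℝ) ≤ B * Real.exp (C * β) ∧
            ∀ w : Fin 4 → ℤ → ℤ, IsFrame b w →
              ClauseIAll r.ρ β w n ε (TypCluster r.ρ θ w (clusterSizeOf θ κ C)) ∧
                KernelPlaqSparseCluster r.ρ β w θ (clusterSizeOf θ κ C) (Real.exp (-(κ * β)))

variable {G : Type} [Group G] [TopologicalSpace G] [IsTopologicalGroup G] [CompactSpace G]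
  [MeasurableSpace G] [BorelSpace G]

/-- **Per-`(G, r)` engine at the served count `clusterSizeOf θ κ C`.**  For every `δ > 0` and `B` there is `β₂'` such that for `β ≥ β₂'`, every mesh
`1 ≤ b ≤ B e^{Cβ}` and every mesh-`b` frame `w`: count-class kernel sparseness at base `e^{−κβ}` gives clause (ii), and `clauseIII_typCluster` gives clause
(iii), both with budget `δ`, for `TypCluster r.ρ θ w (clusterSizeOf θ κ C)`. -/
theorem clauses_typCluster_sizeOf (r : LatticeRep G) {θ κ : ℝ} (hθ : 0 < θ) (hκ : 0 < κ) (C : ℝ) :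
    ∀ δ : ℝ, 0 < δ → ∀ B : ℝ, ∃ β₂' : ℝ, ∀ β : ℝ, β₂' ≤ β →
      ∀ b : ℕ, 1 ≤ b → (b : ℝ) ≤ B * Real.exp (C * β) → ∀ w : Fin 4 → ℤ → ℤ, IsFrame b w →
        (KernelPlaqSparseCluster r.ρ β w θ (clusterSizeOf θ κ C) (Real.exp (-(κ * β))) →
            ClauseIIukp r.ρ β w δ (TypCluster r.ρ θ w (clusterSizeOf θ κ C))) ∧
          ClauseIII r.ρ β w b δ (TypCluster r.ρ θ w (clusterSizeOf θ κ C)) := by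
  intro δ hδ B
  set k : ℕ := clusterSizeOf θ κ C with hkdef
  obtain ⟨β₃, h₃⟩ := clauseIII_typCluster_expMesh (G := G) r hθ C (k := k) (le_max_left _ _) δ hδ B
  have hk' : 4 * max C 0 / κ ≤ k := (Nat.le_ceil _).trans (by exact_mod_cast (le_max_right _ _ : halfExtent κ C ≤ k))
  obtain ⟨β₄, h₄⟩ := clusterBudget hκ C hk' (((2 * k + 1 : ℕ) : ℝ) * 96 * 3750 ^ (2 * k)) δ hδ B
  refine ⟨max 0 (max β₃ β₄), fun β hβ b hb1 hbB w hw => ?_⟩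
  have hβ0 : 0 ≤ β := le_trans (le_max_left _ _) hβ
  have hβ3 : β₃ ≤ β := le_trans (le_trans (le_max_left _ _) (le_max_right _ _)) hβ
  have hβ4 : β₄ ≤ β := le_trans (le_trans (le_max_right _ _) (le_max_right _ _)) hβ
  have hq1 : Real.exp (-(κ * β)) ≤ 1 := by
    rw [Real.exp_le_one_iff, neg_nonpos]
    exact mul_nonneg hκ.le hβ0
  refine ⟨fun hK => clauseIIukp_typCluster_of_kernelSparse r.ρ β hw θ k (Real.exp_pos _).le hq1 ?_ hK, h₃ β hβ3 b hb1 hbB w hw⟩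
  have := h₄ β hβ4 b hbB
  calc ((2 * k + 1 : ℕ) : ℝ) * (96 * (b : ℝ) ^ 4) * 3750 ^ (2 * k) * Real.exp (-(κ * β)) ^ (k + 1)
      = ((2 * k + 1 : ℕ) : ℝ) * 96 * 3750 ^ (2 * k) * (b : ℝ) ^ 4 * Real.exp (-(κ * β)) ^ (k + 1) := by ring
    _ ≤ δ := this

/-- **`TypClusterReducedAtSC ⇒ TypClusterSharpSC` (PROVED).**  Per SC datum: the supplier's `(n, ε, θ)` and `k = clusterSizeOf θ κ C`; (i) is the
supplier's, (ii) from its kernel sparseness, (iii) from the torus anchor. -/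
theorem typClusterSharpSC_of_reducedAt (h : TypClusterReducedAtSC) : TypClusterSharpSC := by
  intro G _ _ _ _ hG hsc
  letI : MeasurableSpace G := borel G
  haveI : BorelSpace G := ⟨rfl⟩
  intro r a ha hat hlb
  obtain ⟨n, ε, θ, κ, C, hn, hε, hM, hθ, hκ, hsup⟩ := h G hG hsc r a ha hat hlb
  refine ⟨n, ε, θ, clusterSizeOf θ κ C, hn, hε, hM, fun δ hδ => ?_⟩
  obtain ⟨T, B, β₂, hβ⟩ := hsup δ hδ
  obtain ⟨β₂', hβ'⟩ := clauses_typCluster_sizeOf (G := G) r hθ hκ C δ hδ B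
  refine ⟨T, max β₂ β₂', fun β hb => ?_⟩
  obtain ⟨b, hb1, hlt, hbB, hw⟩ := hβ β (le_trans (le_max_left _ _) hb)
  refine ⟨b, hb1, hlt, fun w hwf => ?_⟩
  obtain ⟨hI, hK⟩ := hw w hwf
  obtain ⟨hII, hIII⟩ := hβ' β (le_trans (le_max_right _ _) hb) b hb1 hbB w hwf
  exact ⟨hI, hII hK, hIII⟩

/-- **THE RE-CUT IS FREE (PROVED): `TypChainReducedAtSC → TypClusterReducedAtSC`.**  The class of record's reduced lane-A target (p544202)
IMPLIES the count class's, with the SAME printed `(n, ε, θ, κ, C)`, `T, B, β₂` and meshes: clause (i) passes to the SMALLER class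
`TypCluster θ (clusterSizeOf θ κ C) ⊆ TypChain θ (extentOf θ κ C)` (`clauseIAll_typCluster_of_typChain`, `2 · clusterSizeOf = extentOf`), and the kernel
sparseness passes to the count class's guard (`kernelPlaqSparseCluster_of_kernelPlaqSparse`).  So adopting the count class costs a supplier NOTHING,
while it excludes every wall, film or patch threading `clusterSizeOf + 1` bad own plaquettes that the class of record admits below extent `extentOf`. -/
theorem typClusterReducedAtSC_of_typChainReducedAtSC (h : TypChainReducedAtSC) : TypClusterReducedAtSC := by
  intro G _ _ _ _ hG hsc
  letI : MeasurableSpace G := borel G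
  haveI : BorelSpace G := ⟨rfl⟩
  intro r a ha hat hlb
  obtain ⟨n, ε, θ, κ, C, hn, hε, hM, hθ, hκ, hsup⟩ := h G hG hsc r a ha hat hlb
  refine ⟨n, ε, θ, κ, C, hn, hε, hM, hθ, hκ, fun δ hδ => ?_⟩
  obtain ⟨T, B, β₂, hβ⟩ := hsup δ hδ
  refine ⟨T, B, β₂, fun β hb => ?_⟩
  obtain ⟨b, hb1, hlt, hbB, hw⟩ := hβ β hb
  refine ⟨b, hb1, hlt, hbB, fun w hwf => ?_⟩
  obtain ⟨hI, hK⟩ := hw w hwf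
  have hkℓ : 2 * clusterSizeOf θ κ C ≤ extentOf θ κ C + 1 := by rw [extentOf_eq_two_mul_clusterSizeOf]; omega
  exact ⟨clauseIAll_typCluster_of_typChain hkℓ hI, kernelPlaqSparseCluster_of_kernelPlaqSparse hkℓ hK⟩

/-- **`TypClusterReducedAtSC ⇒` I♯_SC (PROVED).** -/
theorem onsetSharpUKPcSC_of_typClusterReducedAtSC (h : TypClusterReducedAtSC) : SharpOnset.OnsetSharpUKPcSC :=
  onsetSharpUKPcSC_of_typClusterSharpSC (typClusterSharpSC_of_reducedAt h)

/-- **`TypClusterReducedAtSC` ∧ residual ⇒ `BalabanLadder.IR` BY NAME (PROVED, E discharged, no X, no torus anchor).** -/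
theorem ir_of_typClusterReducedAtSC (h : TypClusterReducedAtSC) (hN : SharpOnset.IRNSC) :
    Summit.QuantumFields.YangMills.Theses.BalabanLadder.IR :=
  ir_of_typClusterSharpSC (typClusterSharpSC_of_reducedAt h) hN

/-- **The class of record's reduced target reaches `IR` THROUGH THE COUNT CLASS (PROVED)** — the same conclusion as `ir_of_typChainReducedAtSC`, now
witnessed by the format instantiated at the wall-reading class `TypCluster`. -/
theorem ir_of_typChainReducedAtSC_via_cluster (h : TypChainReducedAtSC) (hN : SharpOnset.IRNSC) :
    Summit.QuantumFields.YangMills.Theses.BalabanLadder.IR :=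
  ir_of_typClusterReducedAtSC (typClusterReducedAtSC_of_typChainReducedAtSC h) hN

end Supplier

/-! ## §5 Calibration by name against the disprover's wall data: what the count class admits and what it excludes -/
section Calibration

variable {G : Type} [Group G] {N : ℕ} {ρ : G →* Matrix (Fin N) (Fin N) ℂ}

/-- **What the count class ADMITS, exactly (PROVED)**: if the `θ`-bad own plaquettes of `U` carry labels such that two of them within
`ℓ∞`-distance `2` share a label and every label class has at most `k` members (i.e. every `2`-step-connected bad component has `≤ k` plaquettes —
sparse dust, small frustrated clusters), then `U ∈ TypCluster ρ θ w k c`: a cluster walk stays inside one label class.  This is the residual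
(i)-exposure of the count class, by format (cf. disprove-1 GEN 13's `IsPatchwork`, whose patches are bounded in EXTENT instead). -/
theorem mem_typCluster_of_sparseLabels {θ : ℝ} {w : Fin 4 → ℤ → ℤ} {k : ℕ} {c : Fin 4 → ℤ} {U : LGConfig 4 G} (lab : ZdPlaquette 4 → ℕ)
    (hstep : ∀ p ∈ cellPlaqs w c, ∀ q ∈ cellPlaqs w c, θ ≤ plaqAction ρ p U → θ ≤ plaqAction ρ q U →
      supNormZ4 (p.1 - q.1) ≤ 2 → lab p = lab q)
    (hsmall : ∀ p ∈ cellPlaqs w c, θ ≤ plaqAction ρ p U →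
      ((cellPlaqs w c).filter fun q => θ ≤ plaqAction ρ q U ∧ lab q = lab p).card ≤ k) :
    U ∈ TypCluster ρ θ w k c := by
  classical
  rintro ⟨n, ch, -, hin, hbad, hst, hcard⟩
  have hin' : ∀ i, ch i ∈ cellPlaqs w c := fun i => Finset.mem_coe.1 (hin i)
  -- the label is constant along the walk
  have hlab : ∀ m (hm : m < n + 1), lab (ch ⟨m, hm⟩) = lab (ch 0) := by
    intro m
    induction m with
    | zero => intro _; rfl
    | succ m ih =>
      intro hm
      rw [← ih (by omega)]
      exact (hstep _ (hin' ⟨m, by omega⟩) _ (hin' ⟨m + 1, hm⟩) (hbad _) (hbad _) (hst ⟨m, by omega⟩)).symm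
  have hsub : Finset.univ.image ch ⊆ (cellPlaqs w c).filter fun q => θ ≤ plaqAction ρ q U ∧ lab q = lab (ch 0) := by
    intro p hp
    obtain ⟨i, -, rfl⟩ := Finset.mem_image.1 hp
    exact Finset.mem_filter.2 ⟨hin' i, hbad i, hlab i.1 i.2⟩
  have h1 := Finset.card_le_card hsub
  have h2 := hsmall _ (hin' 0) (hbad 0)
  omega

/-- The disprover's wall chain steps by `−e₂`: consecutive base points are at `ℓ∞`-distance `1`. -/
theorem supNormZ4_wallChain_step (w : Fin 4 → ℤ → ℤ) (c : Fin 4 → ℤ) (k : ℕ) (t : Fin k) :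
    supNormZ4 ((DeepFilm.wallChain w c k t.castSucc).1 - (DeepFilm.wallChain w c k t.succ).1) ≤ 2 := by
  have hdiff : (DeepFilm.wallChain w c k t.castSucc).1 - (DeepFilm.wallChain w c k t.succ).1 = Pi.single 2 (-1 : ℤ) := by
    ext i
    simp only [DeepFilm.wallChain, Pi.sub_apply, Pi.add_apply, Pi.single_apply, Fin.val_castSucc, Fin.val_succ]
    split_ifs <;> push_cast <;> ring
  rw [hdiff, DeepFilm.supNormZ4_single]; decide

/-- The disprover's wall chain is injective (its base points differ in the coordinate `2`). -/
theorem wallChain_injective (w : Fin 4 → ℤ → ℤ) (c : Fin 4 → ℤ) (k : ℕ) : Function.Injective (DeepFilm.wallChain w c k) := by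
  intro s t hst
  have h := congrArg (fun p : ZdPlaquette 4 => p.1 2) hst
  simp only [DeepFilm.wallChain, Pi.add_apply, Pi.single_eq_same] at h
  exact Fin.ext (by exact_mod_cast (add_left_cancel h))

/-- **The wall line is excluded BY COUNT (PROVED)**: in a mesh-`b` frame with `b ≥ 2` and `k + 2 ≤ b`, for every cell `c` and every threshold
`θ ≤ N − Re tr ρ g`, disprove-1 GEN 12's wall line `lineConfig g …` of the cell's bottom layer — core-clean at every depth `≥ 1`, hence typical for
EVERY deep class (`DeepFilm.exists_deepTypical_not_mem_typChain`) — is NOT in `TypCluster ρ θ w k c`: its first `k + 1` wall plaquettes are an injective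
`θ`-bad chain (`not_mem_typCluster_of_injective`).  The count reading sees the wall through its number of bad plaquettes, not its extent or depth. -/
theorem lineConfig_not_mem_typCluster {b : ℕ} {w : Fin 4 → ℤ → ℤ} (hw : IsFrame b w) (hb : 2 ≤ b) {k : ℕ} (hk : k + 2 ≤ b)
    (c : Fin 4 → ℤ) {θ : ℝ} {g : G} (hg : θ ≤ (N : ℝ) - (ρ g).trace.re) :
    DeepFilm.lineConfig g (w 0 (c 0)) (w 1 (c 1)) ∉ TypCluster ρ θ w k c :=
  not_mem_typCluster_of_injective (DeepFilm.wallChain w c k) (wallChain_injective w c k)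
    (fun t => DeepFilm.wallChain_mem_cellPlaqs hw hb (by omega) c t)
    (fun t => by rw [DeepFilm.plaqAction_wallChain]; exact hg) (supNormZ4_wallChain_step w c k)

end Calibration

end Summit.QuantumFields.YangMills.Cruxes.IR.AfPincerUc.SharpLanes

end
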